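import Literature.Combinatorics.Optimization.RegularPolygonPsdLifts
import HarnessLib

/-!
# The regular octagon has psd rank exactly four (Vandaele–Gillis–Glineur, Example 5.2) — PROVED

Source. A. Vandaele, F. Glineur, N. Gillis, *Algorithms for positive semidefinite factorization*,
Comput. Optim. Appl. 71 (2018) 193–219 = arXiv:1707.07953 [VandaeleGlineurGillis2017] (held text
`paper:arxiv-1707.07953`; §5.1 "Conjecture on the psd-rank of regular `n`-gons" and Example 5.2 on
chunks p0012–p0013). Context in the tree: Fawzi–Saunderson–Parrilo's equivariant lift gives
`rank_psd(S_8) ≤ 5` (`RegularPolygon.regularOctagon_psdRank_bounds`: `4 ≤ rank_psd S_8 ≤ 5`), GRT 2013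
Thm. 4.7 gives `≥ 4`; VGG p12: "it is known that (i) the psd-rank of the square is three, (ii) all
pentagons and hexagons have psd-rank exactly four and (iii) the psd-rank of the heptagons is either
four or five [GRT13]" (all three in `PsdMinimalPolytopes.lean` / `PentagonsPsdRankFour.lean`), "By
trial and error … we were able to construct, for the first time, an exact PSD factorization of the
`5`-gon, the `8`-gon and the `10`-gon with respective sizes consistent with Conjecture 1"
(`rank_psd(S_n) = 1 + ⌈log₂ n⌉`).

Contents (all PROVED, axioms standard; no named facts):

* `RegularOctagon.vggSlack` — the printed slack matrix `S_8` (p13: circulant, first row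
  `(0, 1, 1+√2, 2+√2, 2+√2, 1+√2, 1, 0)`); `RegularOctagon.vertex8` — the regular octagon with vertices
  `(±(1+√2), ±1), (±1, ±(1+√2))` (counterclockwise from `(1+√2, 1)`), whose vertex/edge slack matrix is
  `2√2 · S_8` (`polygonSlack_vertex8`) and which IS the regular octagon `X_8` of
  `RegularPolygon.vertex 8` (vertex angles `(2k+1)π/8`) dilated by `ρ = √(4+2√2)` (`vertex8_eq`,
  through `ρ cos(π/8) = 1 + √2`, `ρ sin(π/8) = 1`); `isConvexPolygon_vertex8`.
* **Example 5.2** `RegularOctagon.hasPsdFactorization_vggSlack_four`: an `S^4_+`-factorization of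
  `S_8`. The ROW factors are the printed rank-one matrices `A_i = a^i (a^i)ᵀ`
  (`a^4 = (1,−α₁,−α₁,0)`, `a^5 = (1,α₃,α₃,−1/α₁)`, …, `α₁ = √(1+√2) =: τ`, `α₃ = 1/α₁ − α₁`). RECORDED
  DEVIATION for the COLUMN factors: the printed `4 × 2` Cholesky-type factors `b^j` use the further
  radicals `α₂ = √(2+√2)`, `α₄ = 2^{1/4}`, `α₅`, and a literal transcription of the printed `b^5` does
  not reproduce the fifth column of `S_8`; here every column matrix is RE-DERIVED exactly: `B_j` must
  annihilate `a^j, a^{j+1}` (the two zeros of column `j`), so `B_j = P_j G_j P_jᵀ` for the `2 × 2` Gram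
  matrix `G_j` on `{a^j, a^{j+1}}^⊥`, which the six remaining entries of the column determine LINEARLY;
  all eight systems are consistent over the number field `ℚ(τ)` (`τ⁴ = 2τ² + 1`, `√2 = τ² − 1`,
  `1/α₁ = τ³ − 2τ`) with `G_j ⪰ 0`, and the `LDLᵀ` form gives `B_j = d₁(j) v_j v_jᵀ + d₂(j) w_j w_jᵀ`
  with `d ∈ {1, τ², 1+τ², τ²−1 = √2, 3−τ² = 2−√2} > 0` and `v_j, w_j ∈ ℤ[τ]⁴` (`octRow`, `octD1`,
  `octV`, `octD2`, `octW`; e.g. `B_5 = (1,−τ,τ,τ)⊗² + (τ,1,0,1)⊗²`). The 64 identities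
  `S_{ij} = d₁(j)(a^i·v_j)² + d₂(j)(a^i·w_j)²` are polynomial identities in `τ` checked by `ring`
  after reducing powers `τ^k`, `k ≤ 14`, with the minimal polynomial.
* `RegularOctagon.vertex8_psdRank_four` and **`RegularPolygon.regularOctagon_psdRank_four`**: the
  regular octagon has psd rank EXACTLY four (`HasPsdFactorization (polygonSlack (RegularPolygon.vertex 8)) 4`
  and no factorization of size `3`), lift form `RegularPolygon.regularOctagon_hasPsdLift_four`
  (`conv X_8 = π(S^4_+ ∩ L)` and no psd lift of size `< 4`). This confirms Conjecture 1 at `n = 8`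
  (`1 + ⌈log₂ 8⌉ = 4`) and strictly improves the equivariant bound `5`.

NOT here: Example 5.1 (the regular pentagon, size `4` — every pentagon has psd rank four is already
`GouveiaRobinsonThomas2015_ex32`), Example 5.3 (the regular `10`-gon, an `S^5_+`-factorization over
`ℚ(φ)` with further radicals), Conjecture 1 itself (open), the algorithms of §§3–4.
-/

noncomputable section

open Matrix Finset
open scoped MatrixOrder

namespace Literature.Combinatorics.Optimization

namespace RegularOctagon

/-- `τ = √(1 + √2)` (VGG's `α₁`), a generator of the number field `ℚ(τ)`, `τ⁴ = 2τ² + 1`, in which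
the whole factorization lives (`√2 = τ² − 1`, `1/α₁ = τ³ − 2τ`, `α₃ = 1/α₁ − α₁ = τ³ − 3τ`).
[cite: VandaeleGlineurGillis2017, Ex. 5.2 (p13, "Let `α₁ = √(1+√2)`")] -/
def tau : ℝ := Real.sqrt (1 + Real.sqrt 2)

/-- `τ² = 1 + √2`. [cite: VandaeleGlineurGillis2017, Ex. 5.2 (p13)] -/
theorem tau_sq : tau ^ 2 = 1 + Real.sqrt 2 := Real.sq_sqrt (by positivity)

/-- `√2 = τ² − 1`. [cite: VandaeleGlineurGillis2017, Ex. 5.2 (p13)] -/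
theorem sqrt_two_eq : Real.sqrt 2 = tau ^ 2 - 1 := by
  rw [tau_sq]; ring

/-- The minimal polynomial: `τ⁴ = 2τ² + 1`. [cite: VandaeleGlineurGillis2017, Ex. 5.2 (p13)] -/
theorem tau_pow_four : tau ^ 4 = 2 * tau ^ 2 + 1 := by
  have h2 : Real.sqrt 2 ^ 2 = 2 := Real.sq_sqrt (by norm_num)
  have h : tau ^ 4 = (tau ^ 2) ^ 2 := by ring
  rw [h, tau_sq]
  nlinarith [h2]

/-- `τ > 0`. [cite: VandaeleGlineurGillis2017, Ex. 5.2 (p13)] -/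
theorem tau_pos : 0 < tau := Real.sqrt_pos.mpr (by positivity)

/-- `1 ≤ τ²`. [cite: VandaeleGlineurGillis2017, Ex. 5.2 (p13)] -/
theorem one_le_tau_sq : 1 ≤ tau ^ 2 := by
  rw [tau_sq]
  have := Real.sqrt_nonneg 2
  linarith

/-- `τ² < 3` (i.e. `√2 < 2`). [cite: VandaeleGlineurGillis2017, Ex. 5.2 (p13)] -/
theorem tau_sq_lt_three : tau ^ 2 < 3 := by
  rw [tau_sq]
  have : Real.sqrt 2 < 2 := (Real.sqrt_lt' (by norm_num)).mpr (by norm_num)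
  linarith

/-- **VGG's slack matrix `S_8` of the regular octagon** (p13, verbatim display): circulant with first
row `(0, 1, 1+√2, 2+√2, 2+√2, 1+√2, 1, 0)`, `S_{ij} = r_{j−i}`. [cite: VandaeleGlineurGillis2017, Ex. 5.2 (p13)] -/
def vggSlack : Matrix (Fin 8) (Fin 8) ℝ :=
  Matrix.of fun i j =>
    ![0, 1, 1 + Real.sqrt 2, 2 + Real.sqrt 2, 2 + Real.sqrt 2, 1 + Real.sqrt 2, 1, 0] (j - i)

/-- A regular octagon with vertices in `ℤ[√2]²`: `(±(1+√2), ±1), (±1, ±(1+√2))` counterclockwise,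
starting at `(1+√2, 1)` — the regular octagon `X_8` of `RegularPolygon.vertex 8` (vertex angles
`(2i+1)π/8`) scaled by `√(4+2√2)`. [cite: VandaeleGlineurGillis2017, Ex. 5.2 (p13)] -/
def vertex8 : Fin 8 → (Fin 2 → ℝ) :=
  ![![1 + Real.sqrt 2, 1], ![1, 1 + Real.sqrt 2], ![-1, 1 + Real.sqrt 2], ![-(1 + Real.sqrt 2), 1],
    ![-(1 + Real.sqrt 2), -1], ![-1, -(1 + Real.sqrt 2)], ![1, -(1 + Real.sqrt 2)], ![1 + Real.sqrt 2, -1]]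

/-- The vertex/edge slack matrix of this octagon is `2√2 · S_8`. [cite: VandaeleGlineurGillis2017, Ex. 5.2 (p13)] -/
theorem polygonSlack_vertex8 (i j : Fin 8) :
    polygonSlack vertex8 i j = 2 * Real.sqrt 2 * vggSlack i j := by
  have h4 : tau ^ 4 = 2 * tau ^ 2 + 1 := tau_pow_four
  fin_cases i <;> fin_cases j <;>
    simp [polygonSlack_apply, vertex8, vggSlack, sqrt_two_eq, -mul_eq_mul_left_iff,
      -mul_eq_mul_right_iff, -mul_eq_zero, -zero_eq_mul] <;>
    ring_nf <;> simp only [h4] <;> ring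

/-- The octagon `vertex8` is a convex octagon (counterclockwise, strictly convex).
[cite: VandaeleGlineurGillis2017, Ex. 5.2 (p13)] -/
theorem isConvexPolygon_vertex8 : IsConvexPolygon vertex8 := by
  have hs : 0 < Real.sqrt 2 := Real.sqrt_pos.mpr (by norm_num)
  intro i j h1 h2
  rw [polygonSlack_vertex8]
  fin_cases i <;> fin_cases j <;> simp [vggSlack] at h1 h2 ⊢ <;> positivity

/-! ### The `S^4_+`-factorization over `ℚ(τ)` -/

/-- Row factors `a^i` (p13, verbatim, with `α₁ = τ`, `1/α₁ = τ³ − 2τ`, `α₃ = τ³ − 3τ`): the row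
matrices are `A_i = a^i (a^i)ᵀ`. [cite: VandaeleGlineurGillis2017, Ex. 5.2 (p13)] -/
def octRow (t : ℝ) : Fin 8 → Fin 4 → ℝ :=
  ![![1, 0, 0, 0],
    ![0, 1, 0, 0],
    ![0, 0, 1, 0],
    ![1, -t, -t, 0],
    ![1, -3 * t + t ^ 3, -3 * t + t ^ 3, 2 * t - t ^ 3],
    ![0, -1, -2, 1],
    ![0, 0, 1, -1],
    ![-1, 2 * t - t ^ 3, 2 * t - t ^ 3, -2 * t + t ^ 3]]

/-- Weights `d₁(j)` of the first rank-one term of the column matrices `B_j = d₁ v vᵀ + d₂ w wᵀ`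
(re-derived exactly over `ℚ(τ)`; the printed Cholesky-type factors `b^j` use further radicals and the
printed `b^5` does not verify). [cite: VandaeleGlineurGillis2017, Ex. 5.2 (p13)] -/
def octD1 (t : ℝ) : Fin 8 → ℝ := ![1, 1, 1, 1, 1, t ^ 2, 1, t ^ 2]

/-- Vectors `v_j`. [cite: VandaeleGlineurGillis2017, Ex. 5.2 (p13)] -/
def octV (t : ℝ) : Fin 8 → Fin 4 → ℝ :=
  ![![0, 0, 1, 1],
    ![1, 0, 0, 0],
    ![t, 1, 0, 1],
    ![0, -1, 1, 0],
    ![1, -t, t, t],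
    ![1, -3 * t + t ^ 3, 3 * t - t ^ 3, 3 * t - t ^ 3],
    ![-1, t, -t, -t],
    ![0, 2 - t ^ 2, 1, 3 - t ^ 2]]

/-- Weights `d₂(j)`. [cite: VandaeleGlineurGillis2017, Ex. 5.2 (p13)] -/
def octD2 (t : ℝ) : Fin 8 → ℝ := ![t ^ 2, 1 + t ^ 2, t ^ 2, -1 + t ^ 2, 1, -1 + t ^ 2, 1, 3 - t ^ 2]

/-- Vectors `w_j`. [cite: VandaeleGlineurGillis2017, Ex. 5.2 (p13)] -/
def octW (t : ℝ) : Fin 8 → Fin 4 → ℝ :=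
  ![![0, 0, 0, 1],
    ![0, 0, 0, 1],
    ![0, 0, 0, 1],
    ![t, 1, 0, 1],
    ![t, 1, 0, 1],
    ![0, -1, 1, 1],
    ![0, 0, 1, 1],
    ![0, 1, 0, 1]]

/-- `Tr(u uᵀ (λ v vᵀ + μ w wᵀ)) = λ (u·v)² + μ (u·w)²`. [cite: VandaeleGlineurGillis2017, §2 (rank-one terms of psd factors)] -/
private theorem trace_vecMulVec_mul_two (u v w : Fin 4 → ℝ) (l m : ℝ) :
    (vecMulVec u u * (l • vecMulVec v v + m • vecMulVec w w)).trace =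
      l * (u ⬝ᵥ v) ^ 2 + m * (u ⬝ᵥ w) ^ 2 := by
  simp only [Matrix.mul_add, Matrix.mul_smul, trace_add, trace_smul, vecMulVec_mul_vecMulVec,
    trace_vecMulVec, smul_eq_mul, dotProduct_smul]
  ring

/-- The 64 identities `S_{ij} = d₁(j) (a^i·v_j)² + d₂(j) (a^i·w_j)²` in `ℚ(τ)` (polynomial identities
modulo `τ⁴ = 2τ² + 1`). [cite: VandaeleGlineurGillis2017, Ex. 5.2 (p13)] -/
private theorem vggSlack_eq_factor (i j : Fin 8) :
    vggSlack i j = octD1 tau j * (octRow tau i ⬝ᵥ octV tau j) ^ 2 +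
      octD2 tau j * (octRow tau i ⬝ᵥ octW tau j) ^ 2 := by
  have h4 : tau ^ 4 = 2 * tau ^ 2 + 1 := tau_pow_four
  have h6 : tau ^ 6 = 2 + 5 * tau ^ 2 := by linear_combination (2 + tau ^ 2) * h4
  have h8 : tau ^ 8 = 5 + 12 * tau ^ 2 := by linear_combination (5 + 2 * tau ^ 2 + tau ^ 4) * h4
  have h10 : tau ^ 10 = 12 + 29 * tau ^ 2 := by
    linear_combination (12 + 5 * tau ^ 2 + 2 * tau ^ 4 + tau ^ 6) * h4
  have h12 : tau ^ 12 = 29 + 70 * tau ^ 2 := by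
    linear_combination (29 + 12 * tau ^ 2 + 5 * tau ^ 4 + 2 * tau ^ 6 + tau ^ 8) * h4
  have h14 : tau ^ 14 = 70 + 169 * tau ^ 2 := by
    linear_combination (70 + 29 * tau ^ 2 + 12 * tau ^ 4 + 5 * tau ^ 6 + 2 * tau ^ 8 + tau ^ 10) * h4
  fin_cases i <;> fin_cases j <;>
    simp [vggSlack, octRow, octV, octW, octD1, octD2, dotProduct, Fin.sum_univ_four, sqrt_two_eq,
      -mul_eq_mul_left_iff, -mul_eq_mul_right_iff, -mul_eq_zero, -zero_eq_mul] <;>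
    ring_nf <;> simp only [h4, h6, h8, h10, h12, h14] <;> ring

/-- **`S_8` has an `S^4_+`-factorization** (row factors `a^i (a^i)ᵀ` as printed, column factors
`d₁ v vᵀ + d₂ w wᵀ` re-derived exactly). [cite: VandaeleGlineurGillis2017, Ex. 5.2 (p13)] -/
theorem hasPsdFactorization_vggSlack_four : HasPsdFactorization vggSlack 4 := by
  have hd1 : ∀ j, 0 ≤ octD1 tau j := by
    intro j
    fin_cases j <;> simp [octD1] <;> positivity
  have hd2 : ∀ j, 0 ≤ octD2 tau j := by
    have h1 := one_le_tau_sq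
    have h3 := tau_sq_lt_three
    have habs : 1 ≤ |tau| := by
      rw [abs_of_pos tau_pos]
      nlinarith [tau_pos]
    intro j
    fin_cases j <;> simp [octD2] <;> first | exact habs | linarith
  refine ⟨fun i => vecMulVec (octRow tau i) (octRow tau i),
    fun j => octD1 tau j • vecMulVec (octV tau j) (octV tau j) +
      octD2 tau j • vecMulVec (octW tau j) (octW tau j),
    fun i => ?_, fun j => ?_, fun i j => ?_⟩
  · simpa using posSemidef_vecMulVec_self_star (octRow tau i)
  · exact PosSemidef.add
      (PosSemidef.smul (by simpa using posSemidef_vecMulVec_self_star (octV tau j)) (hd1 j))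
      (PosSemidef.smul (by simpa using posSemidef_vecMulVec_self_star (octW tau j)) (hd2 j))
  · rw [trace_vecMulVec_mul_two]
    exact vggSlack_eq_factor i j

/-- **The regular octagon has psd rank exactly four** ("the regular `8`-gon has psd rank `4`", with
the lower bound GRT 2013 Thm. 4.7 `IsConvexPolygon.not_hasPsdFactorization_three`), for the octagon
`vertex8` with vertices in `ℤ[√2]²`. [cite: VandaeleGlineurGillis2017, Ex. 5.2 (p13) and §5.1] -/
theorem vertex8_psdRank_four :
    HasPsdFactorization (polygonSlack vertex8) 4 ∧ ¬ HasPsdFactorization (polygonSlack vertex8) 3 := by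
  refine ⟨?_, isConvexPolygon_vertex8.not_hasPsdFactorization_three (by norm_num)⟩
  have h := hasPsdFactorization_vggSlack_four.rescale (c := fun _ => 2 * Real.sqrt 2) (d := fun _ => (1 : ℝ))
    (fun _ => by positivity) (fun _ => zero_le_one)
  have hfun : (polygonSlack vertex8 : Fin 8 → Fin 8 → ℝ) = fun i j => 2 * Real.sqrt 2 * vggSlack i j * 1 := by
    funext i j
    rw [polygonSlack_vertex8, mul_one]
  rw [hfun]
  exact h

/-! ### Identification with `RegularPolygon.vertex 8` and the exact psd rank of the regular octagon -/

/-- The circumradius `ρ = √(4 + 2√2)` of `vertex8`. [cite: VandaeleGlineurGillis2017, Ex. 5.2 (p13)] -/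
def rho : ℝ := Real.sqrt (4 + 2 * Real.sqrt 2)

/-- `ρ > 0`. [cite: VandaeleGlineurGillis2017, Ex. 5.2 (p13)] -/
theorem rho_pos : 0 < rho := Real.sqrt_pos.mpr (by positivity)

/-- `ρ = √2 · √(2 + √2)`. [cite: VandaeleGlineurGillis2017, Ex. 5.2 (p13)] -/
theorem rho_eq : rho = Real.sqrt 2 * Real.sqrt (2 + Real.sqrt 2) := by
  rw [rho, ← Real.sqrt_mul (by norm_num : (0:ℝ) ≤ 2)]
  congr 1
  ring

/-- `ρ cos(π/8) = 1 + √2`. [cite: VandaeleGlineurGillis2017, Ex. 5.2 (p13)] -/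
theorem rho_mul_cos : rho * Real.cos (Real.pi / 8) = 1 + Real.sqrt 2 := by
  rw [Real.cos_pi_div_eight, rho_eq]
  have h1 : Real.sqrt (2 + Real.sqrt 2) * Real.sqrt (2 + Real.sqrt 2) = 2 + Real.sqrt 2 :=
    Real.mul_self_sqrt (by positivity)
  have h2 : Real.sqrt 2 * Real.sqrt 2 = 2 := Real.mul_self_sqrt (by norm_num)
  linear_combination (Real.sqrt 2 / 2) * h1 + (1 / 2 : ℝ) * h2

/-- `ρ sin(π/8) = 1`. [cite: VandaeleGlineurGillis2017, Ex. 5.2 (p13)] -/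
theorem rho_mul_sin : rho * Real.sin (Real.pi / 8) = 1 := by
  rw [Real.sin_pi_div_eight, rho_eq]
  have hle : Real.sqrt 2 ≤ 2 := by
    have : Real.sqrt 2 < 2 := (Real.sqrt_lt' (by norm_num)).mpr (by norm_num)
    exact this.le
  have h1 : Real.sqrt (2 + Real.sqrt 2) * Real.sqrt (2 - Real.sqrt 2) = Real.sqrt 2 := by
    rw [← Real.sqrt_mul (by positivity)]
    congr 1
    have h2 : Real.sqrt 2 * Real.sqrt 2 = 2 := Real.mul_self_sqrt (by norm_num)
    nlinarith [h2]
  have h2 : Real.sqrt 2 * Real.sqrt 2 = 2 := Real.mul_self_sqrt (by norm_num)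
  calc Real.sqrt 2 * Real.sqrt (2 + Real.sqrt 2) * (Real.sqrt (2 - Real.sqrt 2) / 2)
      = Real.sqrt 2 * (Real.sqrt (2 + Real.sqrt 2) * Real.sqrt (2 - Real.sqrt 2)) / 2 := by ring
    _ = 1 := by rw [h1, h2]; norm_num

/-- **`vertex8` is the regular octagon `X_8` of FSP/`RegularPolygon.vertex 8` scaled by `ρ`** (vertex
angles `(2k+1)π/8`: `cos, sin` of `π/8, 3π/8, …, 15π/8` in closed form).
[cite: FawziSaundersonParrilo2014, §1.3 (p04)] -/
theorem vertex8_eq (k : Fin 8) : vertex8 k = rho • RegularPolygon.vertex 8 k := by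
  have hc : rho * (Real.sqrt (2 + Real.sqrt 2) / 2) = 1 + Real.sqrt 2 := by
    rw [← Real.cos_pi_div_eight]; exact rho_mul_cos
  have hs : rho * (Real.sqrt (2 - Real.sqrt 2) / 2) = 1 := by
    rw [← Real.sin_pi_div_eight]; exact rho_mul_sin
  have hA : ∀ k : Fin 8, RegularPolygon.vertexAngle 8 k = (2 * (k : ℕ) + 1 : ℝ) * Real.pi / 8 := by
    intro k; simp [RegularPolygon.vertexAngle]
  fin_cases k
  · have ha : RegularPolygon.vertexAngle 8 0 = Real.pi / 8 := by rw [hA]; simp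
    ext l; fin_cases l <;> simp [vertex8, RegularPolygon.vertex, ha, hc, hs]
  · have ha : RegularPolygon.vertexAngle 8 1 = Real.pi / 2 - Real.pi / 8 := by
      rw [hA]; simp; ring
    ext l; fin_cases l <;>
      simp [vertex8, RegularPolygon.vertex, ha, Real.cos_pi_div_two_sub, Real.sin_pi_div_two_sub,
        hc, hs]
  · have ha : RegularPolygon.vertexAngle 8 2 = Real.pi / 8 + Real.pi / 2 := by
      rw [hA]; simp; ring
    ext l; fin_cases l <;>
      simp [vertex8, RegularPolygon.vertex, ha, Real.cos_add_pi_div_two, Real.sin_add_pi_div_two,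
        hc, hs]
  · have ha : RegularPolygon.vertexAngle 8 3 = Real.pi - Real.pi / 8 := by
      rw [hA]; simp; ring
    ext l; fin_cases l <;>
      simp [vertex8, RegularPolygon.vertex, ha, Real.cos_pi_sub, Real.sin_pi_sub, hc, hs]
  · have ha : RegularPolygon.vertexAngle 8 4 = Real.pi / 8 + Real.pi := by
      rw [hA]; simp; ring
    ext l; fin_cases l <;>
      simp [vertex8, RegularPolygon.vertex, ha, Real.cos_add_pi, Real.sin_add_pi, hc, hs]
  · have ha : RegularPolygon.vertexAngle 8 5 = (Real.pi / 2 - Real.pi / 8) + Real.pi := by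
      rw [hA]; simp; ring
    ext l; fin_cases l <;>
      simp [vertex8, RegularPolygon.vertex, ha, Real.cos_add_pi, Real.sin_add_pi,
        Real.cos_pi_div_two_sub, Real.sin_pi_div_two_sub, hc, hs]
  · have ha : RegularPolygon.vertexAngle 8 6 = (Real.pi / 8 + Real.pi / 2) + Real.pi := by
      rw [hA]; simp; ring
    ext l; fin_cases l <;>
      simp [vertex8, RegularPolygon.vertex, ha, Real.cos_add_pi, Real.sin_add_pi,
        Real.cos_add_pi_div_two, Real.sin_add_pi_div_two, hc, hs]
  · have ha : RegularPolygon.vertexAngle 8 7 = (Real.pi - Real.pi / 8) + Real.pi := by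
      rw [hA]; simp; ring
    ext l; fin_cases l <;>
      simp [vertex8, RegularPolygon.vertex, ha, Real.cos_add_pi, Real.sin_add_pi,
        Real.cos_pi_sub, Real.sin_pi_sub, hc, hs]

/-- The slack matrix scales quadratically under dilations. [cite: GouveiaRobinsonThomas2013, Lemma 3.1 (p07)] -/
theorem polygonSlack_smul {m : ℕ} [NeZero m] (c : ℝ) (x : Fin m → (Fin 2 → ℝ)) (i j : Fin m) :
    polygonSlack (fun k => c • x k) i j = c ^ 2 * polygonSlack x i j := by
  simp only [polygonSlack_apply, Pi.smul_apply, smul_eq_mul]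
  ring

/-- **The regular octagon `X_8` (`RegularPolygon.vertex 8`) has psd rank exactly four** — closing the
tree's `RegularPolygon.regularOctagon_psdRank_bounds` (`4 ≤ · ≤ 5`, FSP's equivariant lift of size
`5`): the non-equivariant `S^4_+`-factorization of Example 5.2, transported by the dilation `ρ`.
[cite: VandaeleGlineurGillis2017, Ex. 5.2 (p13) and §5.1 (Conjecture 1: `rank_psd(S_n) = 1 + ⌈log₂ n⌉`)] -/
theorem _root_.Literature.Combinatorics.Optimization.RegularPolygon.regularOctagon_psdRank_four :
    HasPsdFactorization (polygonSlack (RegularPolygon.vertex 8)) 4 ∧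
      ¬ HasPsdFactorization (polygonSlack (RegularPolygon.vertex 8)) 3 := by
  refine ⟨?_, (RegularPolygon.isConvexPolygon_vertex (N := 8) (by norm_num)).not_hasPsdFactorization_three
    (by norm_num)⟩
  have h8 : vertex8 = fun k => rho • RegularPolygon.vertex 8 k := funext vertex8_eq
  have h := vertex8_psdRank_four.1
  rw [h8] at h
  have hfun : (polygonSlack (fun k => rho • RegularPolygon.vertex 8 k) : Fin 8 → Fin 8 → ℝ) =
      fun i j => rho ^ 2 * polygonSlack (RegularPolygon.vertex 8) i j * 1 := by
    funext i j
    rw [polygonSlack_smul, mul_one]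
  rw [hfun] at h
  exact (hasPsdFactorization_rescale_iff (M := polygonSlack (RegularPolygon.vertex 8))
    (fun _ => pow_pos rho_pos 2) (fun _ => one_pos)).mp h

/-- Lift form: the regular octagon is a linear image of an affine slice of `S^4_+` and of no smaller
psd cone. [cite: VandaeleGlineurGillis2017, Ex. 5.2 (p13)] -/
theorem _root_.Literature.Combinatorics.Optimization.RegularPolygon.regularOctagon_hasPsdLift_four :
    HasPsdLift (convexHull ℝ (Set.range (RegularPolygon.vertex 8))) 4 ∧
      ∀ k, HasPsdLift (convexHull ℝ (Set.range (RegularPolygon.vertex 8))) k → 4 ≤ k := by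
  have hx := RegularPolygon.isConvexPolygon_vertex (N := 8) (by norm_num)
  exact ⟨(hx.hasPsdLift_iff (by norm_num) (by norm_num)).mpr
      RegularPolygon.regularOctagon_psdRank_four.1,
    fun k hk => hx.four_le_of_hasPsdLift (by norm_num) hk⟩

end RegularOctagon

end Literature.Combinatorics.Optimization
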